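import Summits.BirchSwinnertonDyer.BirchSwinnertonDyer.Theorems.PrintCf2RubinValueTwoColemanCoinvariantCharOfClosure
import Literature.NumberTheory.GaloisRepresentations.LubinTateColemanUnitsImageTraceTwo
import HarnessLib

/-!
# Brick (c) at `p = 2`: for `d = 1` the `ℤ/d`-TRACE objects ARE the one-prime objects of the original (c)-chain —
# `N_Σ = N₁`, `Col_Σ(C) = Col₁(C)` under `[Unique (ZMod d)]` (consistency of the trace chain with g12–g16)

Cell `bsd-print-cf2`, width seat `bsd-line-cf2c-w7` g17, route C `PrintCf2RubinValueTwo`, crux of record stmt-BirchSwinnertonDyer-24033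
`TwoVariableMainConjAtSplitTwoQuad` (23720 nominal), BRICK §4(c); `--supports` the crux as a helper.  THEOREMS ONLY (0 sorry, no named fact, no
definition); Theses-free.  BSD is not proved by any of this.

The trace chain (`LubinTateColemanUnitsImageTraceTwo`, `…ColemanCoinvariantCharTrace*`) replaces the transport along
`LinearEquiv.funUnique (ZMod d)` (`unitsImage₁`, `colemanImageSubmodule₁`, `Col β (default)`; `d = 1` only) by the index trace `Σ`.  For `d = 1` the
two coincide, so every `d = 1` statement of g12–g16 is literally the `d = 1` case of its trace version:

* `indexTraceₗ_eq_apply_default` — `Σ G = G(default)`;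
* ★ `unitsImageTrace_eq_unitsImage₁` — `N_Σ = N₁`; ★ `colemanImageTrace_eq_colemanImageSubmodule₁` — `Col_Σ(C) = Col₁(C)`.

## References
* [deShalit1987] E. de Shalit, *Iwasawa theory of elliptic curves with complex multiplication* (1987), I §3.7 (13), §3.8 (17); III §1.4.
-/

noncomputable section

set_option linter.dupNamespace false
set_option autoImplicit false

namespace Summit.BirchSwinnertonDyer.BirchSwinnertonDyer.Theorems.PrintCf2.ColemanCoinvariantTraceUnique

open Literature.NumberTheory.GaloisRepresentations Literature.NumberTheory.GaloisRepresentations.IsNonarchimedeanLocalField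
  Literature.NumberTheory.GaloisRepresentations.LubinTate ValuativeRel Field
open Literature.NumberTheory.EllipticCurves
open Summit.BirchSwinnertonDyer.BirchSwinnertonDyer.Theorems.PrintCf2.ColemanImage

variable {F : Type} [Field F] [ValuativeRel F] [TopologicalSpace F] [IsNonarchimedeanLocalField F]

attribute [local instance] ltNormUniformSpace ltNormIsUniformAddGroup rk1 nF nE fintypeResidueField

variable {p : ℕ} [hp : Fact p.Prime] {d : ℕ} (hd : d.Coprime p)
variable {π : 𝒪[F]} (hπ : (valuation F).IsUniformizer (π : F))
variable (E : ℕ → IntermediateField F (AlgebraicClosure F)) [∀ m, FiniteDimensional F (E m)] [∀ m, Normal F (E m)]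
  [∀ m, IsGalois F (E m)] (hmono : Monotone E) (hE : ∀ m, E m ≤ maxUnramified F) (hdeg : ∀ m, Module.finrank F (E m) = d * p ^ m)
  {σ₀ : absoluteGaloisGroup F} (hσ₀ : IsAbsArithFrob σ₀) (hq : residueFieldCard F = 2)
variable (u : (LTCoeff F)ˣ) (hu : LTCoeff.of F π = residueFieldCard F * u) (γ : 𝒪[F]ˣ)
variable [IsAdicComplete (Ideal.span {intBase F (LTCoeff.of F π)}) (PowerSeries 𝒪[F])] [NeZero d]
variable {θ : ∀ m, unitBall (E m)} (hθ : ∀ m, IsIntegralNormalGen (E m) (θ m))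
  (hcoh : ∀ m, unitBallTrace (hmono (Nat.le_succ m)) (θ (m + 1)) = θ m)
variable [CharZero F] [IsAdicComplete (Ideal.span {(p : 𝒪[F])}) 𝒪[F]] (hI : Ideal.span {(p : 𝒪[F])} ≠ ⊤)
  (hud : ∀ m, (u : LTCoeff F) ^ Module.finrank F (E m) ≠ 1)
variable [Unique (ZMod d)]

omit hp [CharZero F] [IsAdicComplete (Ideal.span {(p : 𝒪[F])}) 𝒪[F]] in
/-- For `d = 1`, `Σ G = G(default)`. [cite: deShalit1987, I §3.8 (17)] -/
theorem indexTraceₗ_eq_apply_default (G : ZMod d → ColemanCoordModule hπ hq (intBase F) u hu γ) :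
    indexTraceₗ hπ hq u hu γ G = G default := by
  rw [indexTraceₗ_apply, Fintype.sum_unique]
  exact congrArg G (Subsingleton.elim _ _)

omit hp [CharZero F] [IsAdicComplete (Ideal.span {(p : 𝒪[F])}) 𝒪[F]] [IsAdicComplete (Ideal.span {intBase F (LTCoeff.of F π)}) (PowerSeries 𝒪[F])]
  [NeZero d] in
/-- For `d = 1`, a `ℤ/d`-indexed family is the constant family of its value at `default`. [cite: deShalit1987, I §3.8 (17)] -/
theorem eq_const_default (G : ZMod d → ColemanCoordModule hπ hq (intBase F) u hu γ) : (fun _ : ZMod d => G default) = G :=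
  funext fun _ => congrArg G (Subsingleton.elim _ _)

include hE hdeg hσ₀ hcoh in
/-- ★ **`N_Σ = N₁` for `d = 1`**: the trace of the Coleman image is the one-prime transport `unitsImage₁` of the original chain.
[cite: deShalit1987, I §3.7 (13), §3.8 (17)] -/
theorem unitsImageTrace_eq_unitsImage₁ :
    unitsImageTrace hd hπ E hmono hE hdeg hσ₀ hq u hu γ hθ hcoh hI hud = unitsImage₁ hd hπ E hmono hE hdeg hσ₀ hq u hu γ hθ hcoh hI hud := by
  ext G
  rw [mem_unitsImageTrace_iff, mem_unitsImage₁_iff]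
  constructor
  · rintro ⟨G', hG', rfl⟩
    rw [indexTraceₗ_eq_apply_default, eq_const_default]
    exact hG'
  · intro hG
    exact ⟨fun _ => G, hG, by rw [indexTraceₗ_eq_apply_default]⟩

variable (hN : DenseRange (Nat.cast : ℕ → 𝒪[F]))
  (C : Set (∀ m, RelNormCoherentUnits hπ (E m))) (hC : IsClosed C) (hCsub : C ⊆ principalCoherentFamilies hπ E hmono)
  (h1 : (fun m => (RelNormCoherentUnits.one : RelNormCoherentUnits hπ (E m))) ∈ C)
  (hmul : ∀ β ∈ C, ∀ β' ∈ C, (fun m => (β m).mul (β' m)) ∈ C) (hinv : ∀ β ∈ C, (fun m => (β m).inv hπ (E m)) ∈ C)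
  (hgal : ∀ σ : absoluteGaloisGroup F, ∀ β ∈ C, (fun m => (β m).galAct σ) ∈ C)

omit [CharZero F] in
include hE hdeg hmono in
/-- ★ **`Col_Σ(C) = Col₁(C)` for `d = 1`**: the trace of `Col(C)` is the one-prime transport `colemanImageSubmodule₁` of the original chain.
[cite: deShalit1987, III §1.4] -/
theorem colemanImageTrace_eq_colemanImageSubmodule₁ :
    colemanImageTrace hd hπ E hmono hE hdeg hσ₀ hq u hu γ hθ hcoh hN C hC hCsub h1 hmul hinv hgal =
      colemanImageSubmodule₁ hd hπ E hmono hE hdeg hσ₀ hq u hu γ hθ hcoh hN C hC hCsub h1 hmul hinv hgal := by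
  ext G
  rw [mem_colemanImageTrace_iff, colemanImageSubmodule₁, Submodule.mem_map]
  constructor
  · rintro ⟨G', hG', rfl⟩
    refine ⟨G', (mem_colemanImageSubmodule hd hπ E hmono hE hdeg hσ₀ hq u hu γ hθ hcoh).mpr hG', ?_⟩
    rw [indexTraceₗ_eq_apply_default, LinearEquiv.coe_coe, LinearEquiv.funUnique_apply]
    exact congrArg G' (Subsingleton.elim _ _)
  · rintro ⟨G', hG', rfl⟩
    refine ⟨G', (mem_colemanImageSubmodule hd hπ E hmono hE hdeg hσ₀ hq u hu γ hθ hcoh).mp hG', ?_⟩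
    rw [indexTraceₗ_eq_apply_default, LinearEquiv.coe_coe, LinearEquiv.funUnique_apply]
    exact congrArg G' (Subsingleton.elim _ _)

end Summit.BirchSwinnertonDyer.BirchSwinnertonDyer.Theorems.PrintCf2.ColemanCoinvariantTraceUnique

end
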